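import Summits.Ventures.PercRepro.MSTightGenuineMembers
import Summits.Ventures.PercRepro.MSTightTwinFreeProduct

/-!
# An empty partner family at a tightening direction: monochromatic differences and the canonical
realisation

Dossier proofs/MINE1-theoremS.md, Addendum 55. Setting: `P = proj r F` tight, the partner family
`K = partner r F` EMPTY (every member of `P` is `r`-free or an `r`-member, never both), and
`X ∩ Y = {∅}` (the excess split with `K = ∅` gives `|X ∩ Y| = 1`, and `∅ ∈ Y` by Theorem (SD)).
Then every NONEMPTY difference `a \ b` of two members of `P` is of type I (`a ∈ F₁`, `b ∈ F₀`) for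
all of its realisations or for none (`sdiff_notMem_diffsY_of_part0_left`,
`sdiff_notMem_diffsY_of_partr_right`, `mem_partr_of_sdiff_mem_diffsY`,
`mem_part0_of_sdiff_mem_diffsY`). With `ρ = Rstar P ∈ P` every difference `z` of `P` has the
canonical realisation `z = (z ∪ ρ) \ (ρ \ z)` (`union_Rstar_mem_of_mem_diffs`,
`Rstar_sdiff_mem_of_mem_diffs`), and the members of `P` mix (`sdiff_Rstar_union_inter_Rstar_mem`:
`(p \ ρ) ∪ (q ∩ ρ) ∈ P`) — all from `mem_iff_parts`. A genuine trace has a member not inside `ρ`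
(`exists_mem_not_subset_Rstar`) and `ρ ≠ ∅` (`Rstar_proj_ne_empty`). The set identities of the
two case analyses are collected in `section Identities`. The cases `ρ ∈ F₀` / `ρ ∈ F₁` are
MSTightPartnerNonemptyCore.lean / MSTightPartnerNonemptyMirror.lean; the assembly is
MSTightPartnerNonempty.lean.
-/

namespace PercRepro.MSTight

open Finset
open scoped FinsetFamily

variable {α : Type*} [DecidableEq α] [Fintype α]

section Basic

variable {r : α} {F : Finset (Finset α)}

omit [Fintype α] in
/-- Every member of the trace is `r`-free or an `r`-member. -/
theorem part0_or_partr_of_mem_proj {q : Finset α} (hq : q ∈ proj r F) :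
    q ∈ part0 r F ∨ q ∈ partr r F := by
  rw [proj_eq_union] at hq
  exact mem_union.1 hq

omit [Fintype α] in
/-- With an empty partner family no member of the trace is on both sides. -/
theorem not_mem_partr_of_mem_part0 (hK : partner r F = ∅) {q : Finset α}
    (hq : q ∈ part0 r F) : q ∉ partr r F := by
  intro h
  have h' : q ∈ partner r F := mem_inter.2 ⟨hq, h⟩
  rw [hK] at h'
  exact notMem_empty _ h'

omit [Fintype α] in
/-- A member of the trace that is not an `r`-member is `r`-free. -/
theorem mem_part0_of_notMem_partr {q : Finset α} (hq : q ∈ proj r F) (h : q ∉ partr r F) :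
    q ∈ part0 r F :=
  (part0_or_partr_of_mem_proj hq).resolve_right h

omit [Fintype α] in
/-- A member of the trace that is not `r`-free is an `r`-member. -/
theorem mem_partr_of_notMem_part0 {q : Finset α} (hq : q ∈ proj r F) (h : q ∉ part0 r F) :
    q ∈ partr r F :=
  (part0_or_partr_of_mem_proj hq).resolve_left h

omit [Fintype α] in
/-- `a ∈ F₁`, `b ∈ F₀` ⟹ `a \ b ∈ Y`. -/
theorem sdiff_mem_diffsY_of_partr_part0 {a b : Finset α} (ha : a ∈ partr r F)
    (hb : b ∈ part0 r F) : a \ b ∈ diffsY r F :=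
  mem_diffs.2 ⟨a, ha, b, hb, rfl⟩

omit [Fintype α] in
/-- `a ∈ F₀`, `b ∈ P` ⟹ `a \ b ∈ X`. -/
theorem sdiff_mem_diffsX_of_part0_left {a b : Finset α} (ha : a ∈ part0 r F)
    (hb : b ∈ proj r F) : a \ b ∈ diffsX r F := by
  rcases part0_or_partr_of_mem_proj hb with hb0 | hb1
  · exact mem_union_left _ (mem_union_left _ (mem_diffs.2 ⟨a, ha, b, hb0, rfl⟩))
  · exact mem_union_right _ (mem_diffs.2 ⟨a, ha, b, hb1, rfl⟩)

omit [Fintype α] in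
/-- `a ∈ P`, `b ∈ F₁` ⟹ `a \ b ∈ X`. -/
theorem sdiff_mem_diffsX_of_partr_right {a b : Finset α} (ha : a ∈ proj r F)
    (hb : b ∈ partr r F) : a \ b ∈ diffsX r F := by
  rcases part0_or_partr_of_mem_proj ha with ha0 | ha1
  · exact mem_union_right _ (mem_diffs.2 ⟨a, ha0, b, hb, rfl⟩)
  · exact mem_union_left _ (mem_union_right _ (mem_diffs.2 ⟨a, ha1, b, hb, rfl⟩))

omit [Fintype α] in
/-- `a ∈ F₁`, `a \ b ∉ Y` (`b ∈ P`) ⟹ `b ∈ F₁`. -/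
theorem mem_partr_of_sdiff_notMem_diffsY {a b : Finset α} (ha : a ∈ partr r F)
    (hb : b ∈ proj r F) (hY : a \ b ∉ diffsY r F) : b ∈ partr r F := by
  rcases part0_or_partr_of_mem_proj hb with hb0 | hb1
  · exact absurd (sdiff_mem_diffsY_of_partr_part0 ha hb0) hY
  · exact hb1

omit [Fintype α] in
/-- `b ∈ F₀`, `a \ b ∉ Y` (`a ∈ P`) ⟹ `a ∈ F₀`. -/
theorem mem_part0_of_sdiff_notMem_diffsY {a b : Finset α} (ha : a ∈ proj r F)
    (hb : b ∈ part0 r F) (hY : a \ b ∉ diffsY r F) : a ∈ part0 r F := by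
  rcases part0_or_partr_of_mem_proj ha with ha0 | ha1
  · exact ha0
  · exact absurd (sdiff_mem_diffsY_of_partr_part0 ha1 hb) hY

omit [Fintype α] in
/-- **Monochromaticity, left.** When `X ∩ Y = {∅}`, a nonempty difference with an `r`-free first
member is not of type I. -/
theorem sdiff_notMem_diffsY_of_part0_left (hXY : diffsX r F ∩ diffsY r F = {∅}) {a b : Finset α}
    (ha : a ∈ part0 r F) (hb : b ∈ proj r F) (hab : a \ b ≠ ∅) : a \ b ∉ diffsY r F := by
  intro hY
  have h : a \ b ∈ diffsX r F ∩ diffsY r F :=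
    mem_inter.2 ⟨sdiff_mem_diffsX_of_part0_left ha hb, hY⟩
  rw [hXY, mem_singleton] at h
  exact hab h

omit [Fintype α] in
/-- **Monochromaticity, right.** When `X ∩ Y = {∅}`, a nonempty difference with an `r`-member as
second member is not of type I. -/
theorem sdiff_notMem_diffsY_of_partr_right (hXY : diffsX r F ∩ diffsY r F = {∅}) {a b : Finset α}
    (ha : a ∈ proj r F) (hb : b ∈ partr r F) (hab : a \ b ≠ ∅) : a \ b ∉ diffsY r F := by
  intro hY
  have h : a \ b ∈ diffsX r F ∩ diffsY r F :=
    mem_inter.2 ⟨sdiff_mem_diffsX_of_partr_right ha hb, hY⟩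
  rw [hXY, mem_singleton] at h
  exact hab h

omit [Fintype α] in
/-- A nonempty type-I difference `a \ b` (`a, b ∈ P`) has `a ∈ F₁`. -/
theorem mem_partr_of_sdiff_mem_diffsY (hXY : diffsX r F ∩ diffsY r F = {∅}) {a b : Finset α}
    (ha : a ∈ proj r F) (hb : b ∈ proj r F) (hab : a \ b ≠ ∅) (hY : a \ b ∈ diffsY r F) :
    a ∈ partr r F := by
  rcases part0_or_partr_of_mem_proj ha with ha0 | ha1
  · exact absurd hY (sdiff_notMem_diffsY_of_part0_left hXY ha0 hb hab)
  · exact ha1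

omit [Fintype α] in
/-- A nonempty type-I difference `a \ b` (`a, b ∈ P`) has `b ∈ F₀`. -/
theorem mem_part0_of_sdiff_mem_diffsY (hXY : diffsX r F ∩ diffsY r F = {∅}) {a b : Finset α}
    (ha : a ∈ proj r F) (hb : b ∈ proj r F) (hab : a \ b ≠ ∅) (hY : a \ b ∈ diffsY r F) :
    b ∈ part0 r F := by
  rcases part0_or_partr_of_mem_proj hb with hb0 | hb1
  · exact hb0
  · exact absurd hY (sdiff_notMem_diffsY_of_partr_right hXY ha hb1 hab)

end Basic

section Canon

variable {P : Finset (Finset α)}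

/-- **Mixing.** In a tight family the part of `p` outside `ρ = Rstar P` and the part of `q` inside
`ρ` assemble to a member. -/
theorem sdiff_Rstar_union_inter_Rstar_mem (hP : Tight P) {p q : Finset α} (hp : p ∈ P)
    (hq : q ∈ P) : (p \ Rstar P) ∪ (q ∩ Rstar P) ∈ P := by
  have hρ : Rstar P ∈ P := Rstar_mem_of_dichotomy (dichotomy_of_tight hP) ⟨p, hp⟩
  rw [mem_iff_parts hP]
  constructor
  · have e : ((p \ Rstar P) ∪ (q ∩ Rstar P)) \ Rstar P = p \ Rstar P := by
      ext x
      simp only [mem_sdiff, mem_union, mem_inter]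
      tauto
    rw [e]
    exact mem_diffs.2 ⟨p, hp, Rstar P, hρ, rfl⟩
  · have e : Rstar P \ ((p \ Rstar P) ∪ (q ∩ Rstar P)) = Rstar P \ q := by
      ext x
      simp only [mem_sdiff, mem_union, mem_inter]
      tauto
    rw [e]
    exact mem_diffs.2 ⟨Rstar P, hρ, q, hq, rfl⟩

/-- The bottom member `ρ \ z` of the canonical realisation of a difference `z`. -/
theorem Rstar_sdiff_mem_of_mem_diffs (hP : Tight P) {z : Finset α} (hz : z ∈ P \\ P) :
    Rstar P \ z ∈ P := by
  obtain ⟨p, hp, q, hq, rfl⟩ := mem_diffs.1 hz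
  rw [mem_iff_parts hP]
  constructor
  · have e : (Rstar P \ (p \ q)) \ Rstar P = ∅ := by
      ext x
      simp only [mem_sdiff, notMem_empty, iff_false, not_and, not_not]
      tauto
    rw [e]
    exact mem_diffs.2 ⟨p, hp, p, hp, Finset.sdiff_self p⟩
  · have e : Rstar P \ (Rstar P \ (p \ q)) = (p ∩ Rstar P) \ q := by
      ext x
      simp only [mem_sdiff, mem_inter, not_and, not_not]
      tauto
    rw [e]
    exact mem_diffs.2 ⟨p ∩ Rstar P, inter_Rstar_mem hP hp, q, hq, rfl⟩

/-- The top member `z ∪ ρ` of the canonical realisation of a difference `z`. -/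
theorem union_Rstar_mem_of_mem_diffs (hP : Tight P) {z : Finset α} (hz : z ∈ P \\ P) :
    z ∪ Rstar P ∈ P := by
  obtain ⟨p, hp, q, hq, rfl⟩ := mem_diffs.1 hz
  have hρ : Rstar P ∈ P := Rstar_mem_of_dichotomy (dichotomy_of_tight hP) ⟨p, hp⟩
  rw [mem_iff_parts hP]
  constructor
  · have e : ((p \ q) ∪ Rstar P) \ Rstar P = (p ∪ Rstar P) \ (q ∪ Rstar P) := by
      ext x
      simp only [mem_sdiff, mem_union, not_or]
      tauto
    rw [e]
    exact mem_diffs.2 ⟨p ∪ Rstar P, mem_union_Rstar_of_mem hP hp, q ∪ Rstar P,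
      mem_union_Rstar_of_mem hP hq, rfl⟩
  · have e : Rstar P \ ((p \ q) ∪ Rstar P) = ∅ := by
      ext x
      simp only [mem_sdiff, mem_union, notMem_empty, iff_false, not_and, not_or, not_not]
      tauto
    rw [e]
    exact mem_diffs.2 ⟨Rstar P, hρ, Rstar P, hρ, Finset.sdiff_self _⟩

end Canon

section Identities

variable {ρ a b c s t p q : Finset α}

omit [Fintype α] in
/-- `(a \ ρ) ∪ c ∪ ρ = a` for `ρ ⊆ a`, `c ⊆ ρ`. -/
theorem sdiff_union_union_eq_of_subset (hρa : ρ ⊆ a) (hcρ : c ⊆ ρ) :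
    (a \ ρ) ∪ c ∪ ρ = a := by
  ext x
  have h1 := @hρa x
  have h2 := @hcρ x
  simp only [mem_union, mem_sdiff]
  tauto

omit [Fintype α] in
/-- `(b ∪ (ρ \ c)) \ ρ = ∅` for `b ⊆ ρ`. -/
theorem union_sdiff_sdiff_eq_empty_of_subset (hbρ : b ⊆ ρ) :
    (b ∪ (ρ \ c)) \ ρ = ∅ := by
  ext x
  have h1 := @hbρ x
  simp only [mem_sdiff, mem_union, notMem_empty, iff_false, not_and, not_not]
  tauto

omit [Fintype α] in
/-- `ρ \ (b ∪ (ρ \ c)) = c \ b` for `c ⊆ ρ`. -/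
theorem sdiff_union_sdiff_eq_of_subset (hcρ : c ⊆ ρ) :
    ρ \ (b ∪ (ρ \ c)) = c \ b := by
  ext x
  have h2 := @hcρ x
  simp only [mem_sdiff, mem_union, not_or, not_and, not_not]
  tauto

omit [Fintype α] in
/-- `((a \ ρ) ∪ c) \ b = a \ (b ∪ (ρ \ c))` for `ρ ⊆ a`, `c ⊆ ρ`, `b ⊆ ρ`. -/
theorem sdiff_union_sdiff_eq_sdiff_union_of_subset (hρa : ρ ⊆ a) (hcρ : c ⊆ ρ)
    (hbρ : b ⊆ ρ) : ((a \ ρ) ∪ c) \ b = a \ (b ∪ (ρ \ c)) := by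
  ext x
  have h1 := @hρa x
  have h2 := @hcρ x
  have h3 := @hbρ x
  simp only [mem_sdiff, mem_union, not_or, not_and, not_not]
  tauto

omit [Fintype α] in
/-- `(t ∪ ρ) \ ((s \ ρ) ∪ c) = ρ \ c` for `t ⊆ s`, `c ⊆ ρ`. -/
theorem union_sdiff_sdiff_union_eq_of_subset (hts : t ⊆ s) (hcρ : c ⊆ ρ) :
    (t ∪ ρ) \ ((s \ ρ) ∪ c) = ρ \ c := by
  ext x
  have h1 := @hts x
  have h2 := @hcρ x
  simp only [mem_sdiff, mem_union, not_or, not_and, not_not]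
  tauto

omit [Fintype α] in
/-- `(s \ ρ) ∪ c ∪ ρ = s ∪ ρ` for `c ⊆ ρ`. -/
theorem sdiff_union_union_eq_union_of_subset (hcρ : c ⊆ ρ) :
    (s \ ρ) ∪ c ∪ ρ = s ∪ ρ := by
  ext x
  have h2 := @hcρ x
  simp only [mem_union, mem_sdiff]
  tauto

omit [Fintype α] in
/-- `ρ \ (q ∩ ρ) = ρ \ q`. -/
theorem sdiff_inter_right_eq_sdiff : ρ \ (q ∩ ρ) = ρ \ q := by
  ext x
  simp only [mem_sdiff, mem_inter, not_and]
  tauto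

omit [Fintype α] in
/-- `((c \ ρ) ∪ b) ∩ ρ = b` for `b ⊆ ρ`. -/
theorem sdiff_union_inter_eq_of_subset (hbρ : b ⊆ ρ) : ((c \ ρ) ∪ b) ∩ ρ = b := by
  ext x
  have h1 := @hbρ x
  simp only [mem_inter, mem_union, mem_sdiff]
  tauto

omit [Fintype α] in
/-- `((a \ c) ∪ ρ) \ ρ = a \ c` for `ρ ⊆ c`. -/
theorem sdiff_union_sdiff_eq_sdiff_of_subset (hρc : ρ ⊆ c) :
    ((a \ c) ∪ ρ) \ ρ = a \ c := by
  ext x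
  have h1 := @hρc x
  simp only [mem_sdiff, mem_union]
  tauto

omit [Fintype α] in
/-- `ρ \ (x ∪ ρ) = ∅`. -/
theorem sdiff_union_right_self_eq_empty : ρ \ (a ∪ ρ) = ∅ :=
  sdiff_eq_empty_iff_subset.2 subset_union_right

omit [Fintype α] in
/-- `a \ ((c \ ρ) ∪ b) = ((a \ c) ∪ ρ) \ b` for `ρ ⊆ a`, `ρ ⊆ c`, `b ⊆ ρ`. -/
theorem sdiff_sdiff_union_eq_sdiff_union_sdiff_of_subset (hρa : ρ ⊆ a)
    (hρc : ρ ⊆ c) (hbρ : b ⊆ ρ) : a \ ((c \ ρ) ∪ b) = ((a \ c) ∪ ρ) \ b := by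
  ext x
  have h1 := @hρa x
  have h2 := @hρc x
  have h3 := @hbρ x
  simp only [mem_sdiff, mem_union, not_or, not_and, not_not]
  tauto

omit [Fintype α] in
/-- `((q \ ρ) ∪ (t ∩ ρ)) \ (s ∩ ρ) = q \ ρ` for `t ⊆ s`. -/
theorem sdiff_union_inter_sdiff_inter_eq_of_subset (hts : t ⊆ s) :
    ((q \ ρ) ∪ (t ∩ ρ)) \ (s ∩ ρ) = q \ ρ := by
  ext x
  have h1 := @hts x
  simp only [mem_sdiff, mem_union, mem_inter, not_and]
  tauto

omit [Fintype α] in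
/-- `((q \ ρ) ∪ (t ∩ ρ)) ∩ ρ = t ∩ ρ`. -/
theorem sdiff_union_inter_inter_eq : ((q \ ρ) ∪ (t ∩ ρ)) ∩ ρ = t ∩ ρ := by
  ext x
  simp only [mem_inter, mem_union, mem_sdiff]
  tauto

omit [Fintype α] in
/-- `((q \ a) ∪ ρ) \ ρ = q \ a` for `ρ ⊆ a`. -/
theorem sdiff_union_sdiff_eq_sdiff_of_subset' (hρa : ρ ⊆ a) :
    ((q \ a) ∪ ρ) \ ρ = q \ a := by
  ext x
  have h1 := @hρa x
  simp only [mem_sdiff, mem_union]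
  tauto

end Identities

section Support

variable {r : α} {F : Finset (Finset α)}

/-- A genuine trace (`univ.erase r ∉ P`, full support off `r`) has a member not inside `ρ`. -/
theorem exists_mem_not_subset_Rstar (hP : Tight (proj r F)) (hS : univ.erase r ∉ proj r F)
    (hsupp : ∀ a, a ≠ r → ∃ p ∈ proj r F, a ∈ p) (hne : (proj r F).Nonempty) :
    ∃ q ∈ proj r F, ¬ q ⊆ Rstar (proj r F) := by
  have hρ : Rstar (proj r F) ∈ proj r F := Rstar_mem_of_dichotomy (dichotomy_of_tight hP) hne
  by_contra h
  push Not at h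
  apply hS
  have e : univ.erase r = Rstar (proj r F) := by
    apply Subset.antisymm
    · intro x hx
      obtain ⟨p, hp, hxp⟩ := hsupp x (mem_erase.1 hx).1
      exact h p hp hxp
    · intro x hx
      exact mem_erase.2 ⟨fun hxr => notMem_of_mem_proj hρ (hxr ▸ hx), mem_univ x⟩
  rw [e]
  exact hρ

/-- The addable part of a nonempty genuine trace is a nonempty member. -/
theorem Rstar_proj_ne_empty (hP : Tight (proj r F)) (hE : (∅ : Finset α) ∉ proj r F)
    (hne : (proj r F).Nonempty) : Rstar (proj r F) ≠ ∅ := fun h =>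
  hE (h ▸ Rstar_mem_of_dichotomy (dichotomy_of_tight hP) hne)

end Support

end PercRepro.MSTight
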